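import Literature.Computability.QuantumComplexity.BosonReductionMachine
import Literature.Computability.QuantumComplexity.PermanentSearchRandom
import Literature.Computability.Complexity.StockmeyerMachines
import HarnessLib

/-!
# Exact BosonSampling: the corrected S20 from Valiant's theorem and one running-time fact

Family `quantum-advantage`; end of the chain `Sampling.lean` (S20, mis-stated) →
`ExactBosonSamplingHardness.lean` (corrected statement
`PSharpP_subset_BPPRelClass_NP_of_uniformExactBosonSampling`, proof from named facts) →
`PermanentSearchRandom.lean` (`…_of_AA13`: from Stockmeyer's theorem, Valiant's theorem,
`PerSearch.randSearchAlg_isPolyTime` and `bosonReduction_mem_FP`) → `BosonReductionCodes.lean` /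
`BosonReductionMachine.lean` (the re-based reduction maps `BosonFP.bPre/bQuery/bPost`, in `FP` by
construction, with their values on well-formed `Per²`-queries). Source: S. Aaronson, A. Arkhipov,
*The computational complexity of linear optics*, Theory of Computing 9 (2013), proof of Thm. 1.1
(p. 178) with Thm. 4.1 (Stockmeyer), Thm. 4.2 (Valiant), Thm. 4.3, Cor. 4.5.

This file re-assembles the proof of the corrected S20 on the re-based reduction, removing the
book-keeping fact `bosonReduction_mem_FP` from its hypotheses:

* `bOracle qA cS F` — the coin-taking `Per²`-oracle `w ↦ bPost qA ⟨w, F (bQuery qA cS w)⟩` built from a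
  sampler with coin polynomial `qA` and a Stockmeyer counter `F` (coin polynomial `cS`);
  `bOracle_mem_FPRel` (`∈ FP^L` for `F ∈ FP^L`, by the transcript closure `FPRel_comp_FP_holds` and
  `bQuery_mem_FP`, `bPost_mem_FP`); `decodeNat_bOracle_perSqQuery` (its answer is the rescaled count);
* `bosonRescale_mem_perSqWindow_tOf` — the window estimate of `ExactBosonSamplingHardness.lean`
  (`rescale_bounds`, eqs. (4.20)–(4.23)) at the precision `t = 3 |⟨X⟩|` (admissible by
  `BosonCodes.pairDiag_le_four_pow`), with the normalisation `bosonSamplingPMF_apply_holds` fed in;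
* `perSqRandOracleSolves_bOracle` — the oracle `(2c+1)`-approximates `Per²` except on a `1/k`
  fraction of the coins (Stockmeyer's guarantee transported along `u ↦ u ↾ ℓ'`);
* **`PSharpP_subset_BPPRelClass_NP_of_uniformExactBosonSampling_of_hardness`** — the corrected S20
  from Stockmeyer's theorem (a hypothesis, discharged by `StockMachine.stockmeyerApproxCounting_holds`)
  and AA13 Thm. 4.3 in randomised-oracle form (`PSharpP_subset_BPPRel_of_perSqRandOracleSolves`);
* **`PSharpP_subset_BPPRelClass_NP_of_uniformExactBosonSampling_of_valiant`** — the corrected S20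
  from exactly Valiant's theorem (`permanent01_isSharpPHardFun`, AA13 Thm. 4.2) and the running-time
  fact `PerSearch.randSearchAlg_isPolyTime` of the Thm-4.3 search; everything else — Stockmeyer
  counting, the exact-dyadic completion, the reduction machine, the `BPP` machine of Thm. 4.3 — is
  proved. The trust base of the corrected S20 is thereby reduced to these two named facts.

## References

* S. Aaronson, A. Arkhipov, *The computational complexity of linear optics*, Theory of Computing 9
  (2013) 143–252: Thm. 1.1 (p. 149), Thm. 4.1–4.3 (pp. 175–177), proof of Thm. 1.1 and Cor. 4.5
  (p. 178).
* L. G. Valiant, *The complexity of computing the permanent*, Theoret. Comput. Sci. 8 (1979), Thm. 1.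
* S. Arora, B. Barak, *Computational Complexity: A Modern Approach*, CUP 2009, §3.4, §7.4.1, §17.2.
-/

open MeasureTheory Matrix Computability Literature.Computability.Complexity
  Literature.Computability.Complexity.Nondeterministic Literature.Computability.Complexity.Classes
  Literature.Computability.Cryptography Finset

namespace Literature.Computability.QuantumComplexity

open BosonFP BosonCodes

variable {n : ℕ}

/-! ### The oracle built from a uniform sampler and a Stockmeyer counter -/

/-- **The coin-taking `Per²`-oracle of the re-based reduction**: on `w = ⟨⟨⟨X⟩, 1ᵏ⟩, u⟩`, form the
count query `bQuery qA cS w`, ask the counter `F`, and rescale its answer with `bPost qA`. This is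
the `FBPP^{NP}` procedure of AA13's proof of Thm. 1.1 (p. 178) as a deterministic function of
(query, coins), on the instance family at precision `3 |⟨X⟩|`. [cite: AaronsonArkhipovToC2013, proof of Thm. 1.1 (p. 178)] -/
noncomputable def bOracle (qA cS : Polynomial ℕ) (F : List Bool → List Bool) : Oracle :=
  fun w => bPost qA (boolPair w (F (bQuery qA cS w)))

/-- **The oracle is in `FP^O` whenever the counter is** (transcript closure of `FP^O` under
polynomial-time pre- and post-processing, `FPRel_comp_FP_holds`, with `bQuery_mem_FP`, `bPost_mem_FP`).
[cite: AroraBarakCC2009, §3.4] -/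
theorem bOracle_mem_FPRel {O : Oracle} {F : List Bool → List Bool} (hF : F ∈ FPRel O)
    (qA cS : Polynomial ℕ) : bOracle qA cS F ∈ FPRel O :=
  FPRel_comp_FP_holds O F (bQuery qA cS) (bPost qA) hF (bQuery_mem_FP qA cS) (bPost_mem_FP qA)

/-- **The oracle's answer on a well-formed query**: the rescaled Stockmeyer estimate of the number
of coin strings on which the sampler outputs the planted outcome, at precision `t = 3 |⟨X⟩|`. [folklore] -/
theorem decodeNat_bOracle_perSqQuery (qA cS : Polynomial ℕ) (F : List Bool → List Bool)
    (M : Fin n → Fin n → ℤ) (k : ℕ) (u : List Bool) :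
    decodeNat (bOracle qA cS F (perSqQuery M k u)) =
      bosonRescale n (tOf M) (countEstimate F (bPre (qcode M)) (mOf qA M) 1 k (u.take (ellOf qA cS M k)))
        (mOf qA M) := by
  simp only [bOracle]
  rw [bQuery_apply, bPost_apply, decode_encodeNat, countEstimate_def]

/-! ### The estimate is in the window (eqs. (4.20)–(4.23) at precision `3 |⟨X⟩|`) -/

/-- **The estimate is in the window.** For a sampler within the factor `c ≥ 1` of
`bosonSamplingProblem` using exactly `qA |x|` coins, and a count `N` within the factor `2` of the
number of its coin strings producing the planted outcome on the instance of `X` at precision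
`t = 3 |⟨X⟩|` (`n ≥ 1`), the rescaled value `⌈(N/2^m) · 4^{tn} n!⌉` is within the factor `2c + 1` of
`Per(X)²`. The precision is admissible by `pairDiag_le_four_pow`; the normalisation
`𝒟_A(s) = |Per(A_s)|²/n!` is `bosonSamplingPMF_apply_holds`. [cite: AaronsonArkhipovToC2013, proof of Thm. 1.1, eqs. (4.20)–(4.23) (p. 178)] -/
theorem bosonRescale_mem_perSqWindow_tOf {A : RandAlg (List Bool) (List Bool)} {c : ℝ} (hc : 1 ≤ c)
    (hmul : A.SamplesMultiplicative bosonSamplingProblem c) {qA : Polynomial ℕ}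
    (hqA : ∀ m, A.coinLen m = qA.eval m) (M : Fin n → Fin n → ℤ) (hn : 0 < n) {N : ℕ}
    (hN : IsApproxCount 1 (countWitnesses (samplerRel A) (mOf qA M) (bPre (qcode M))) N) :
    bosonRescale n (tOf M) N (mOf qA M) ∈ perSqWindow (2 * c + 1) M := by
  set t : ℕ := tOf M with ht_def
  set x₀ : List Bool := gramInstanceCode (Matrix.of M) t with hx₀
  set y₀ : List Bool := diagOutcomeCode n t with hy₀
  have hpre : bPre (qcode M) = boolPair x₀ y₀ := bPre_apply M
  have hm : mOf qA M = A.coinLen x₀.length := by rw [mOf, hqA]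
  rw [hm, hpre] at hN
  rw [hm]
  set m : ℕ := A.coinLen x₀.length with hm_def
  set p : ℝ := (A.outputPMF id x₀ y₀).toReal with hp
  set P : ℝ := ((Matrix.of M).permanent : ℝ) ^ 2 with hP
  set Mx : ℝ := 4 ^ (t * n) * (n.factorial : ℝ) with hMx
  have ht : ∀ j, pairDiag (Matrix.of M) j ≤ 4 ^ t := fun j => pairDiag_le_four_pow M j
  have hD : (bosonSamplingProblem x₀ y₀).toReal = P / Mx :=
    toReal_bosonSamplingProblem_gramInstance (Matrix.of M) hn t ht bosonSamplingPMF_apply_holds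
  have hm12 : (bosonSamplingProblem x₀ y₀).toReal / c ≤ p ∧
      p ≤ c * (bosonSamplingProblem x₀ y₀).toReal := hmul x₀ y₀
  rw [hD] at hm12
  have hcount : p = (countWitnesses (samplerRel A) m (boolPair x₀ y₀) : ℝ) / 2 ^ m :=
    toReal_outputPMF_apply A x₀ y₀
  obtain ⟨hlo, hhi⟩ := approxCount_one_div_bounds hcount hN
  have hz : (bosonRescale n t N m : ℝ) < 1 → (bosonRescale n t N m : ℝ) = 0 := fun hz1 => by
    have : bosonRescale n t N m < 1 := by exact_mod_cast hz1
    rw [Nat.lt_one_iff.mp this, Nat.cast_zero]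
  have hM0 : 0 < Mx :=
    mul_pos (pow_pos (by norm_num) _) (Nat.cast_pos.2 (Nat.factorial_pos n))
  exact rescale_bounds hc hM0 (sq_nonneg _) (permanent_sq_eq_zero_or_one_le (Matrix.of M))
    hm12.1 hm12.2 hlo hhi (bosonRescale_ge n t N m) (bosonRescale_lt n t N m) hz

/-! ### The oracle solves `Per²`-approximation -/

/-- **The oracle built from a uniform factor-`c` sampler `(2c+1)`-approximates `Per²`.** If the
sampler is within the factor `c ≥ 1` of `bosonSamplingProblem` and uses exactly `qA |x|` coins, and
`F` is a Stockmeyer counter for its coin predicate with coin polynomial `cS` (the conclusion of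
`stockmeyerApproxCounting`), then `bOracle qA cS F` answers within `[Per(X)²/(2c+1), (2c+1) Per(X)²]`
except for a fraction `≤ 1/k` of the coin strings of every length `ℓ ≥ cS (r(s) + qA (r(s)) + 1 + s)`,
`s = |⟨X⟩| + k`, `r` a length bound of `bPre` (AA13 p. 178: "by Theorem 4.1, we can approximate `p_A`
to within a multiplicative factor of `g` in `FBPP^{NP^𝒪}`. It follows that we can approximate
`|Per(X)|² = Per(X)²` in `FBPP^{NP^𝒪}` as well"). [cite: AaronsonArkhipovToC2013, proof of Thm. 1.1 (p. 178)] -/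
theorem perSqRandOracleSolves_bOracle {A : RandAlg (List Bool) (List Bool)} {c : ℝ}
    (hc : 1 ≤ c) (hmul : A.SamplesMultiplicative bosonSamplingProblem c) {qA : Polynomial ℕ}
    (hqA : ∀ m, A.coinLen m = qA.eval m) {F : List Bool → List Bool} {cS : Polynomial ℕ}
    (hF : ∀ (x : List Bool) (m kη kδ : ℕ), 0 < kη → 0 < kδ →
      uniformProb (cS.eval (x.length + m + kη + kδ))
        {u | ¬ IsApproxCount kη (countWitnesses (samplerRel A) m x) (countEstimate F x m kη kδ u)} ≤
          1 / (kδ : ℝ)) :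
    PerSqRandOracleSolves (2 * c + 1) (bOracle qA cS F) := by
  obtain ⟨r, hr⟩ := exists_poly_length_le_of_mem_FP bPre_mem_FP
  refine ⟨cS.comp (r + qA.comp r + 1 + Polynomial.X), fun n M k ℓ hn hk hℓ => ?_⟩
  change (cS.comp (r + qA.comp r + 1 + Polynomial.X)).eval ((qcode M).length + k) ≤ ℓ at hℓ
  -- the counter's coins fit into the supplied ones
  have h1 : (bPre (qcode M)).length ≤ r.eval ((qcode M).length + k) :=
    (hr _).trans (TM2Iter.eval_mono r (Nat.le_add_right _ _))
  have hx0len : (gramInstanceCode (Matrix.of M) (tOf M)).length ≤ (bPre (qcode M)).length := by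
    rw [bPre_apply, length_boolPair]; omega
  have h2 : mOf qA M ≤ qA.eval (r.eval ((qcode M).length + k)) := TM2Iter.eval_mono qA (hx0len.trans h1)
  have hℓ'ℓ : ellOf qA cS M k ≤ ℓ := by
    refine le_trans ?_ hℓ
    rw [ellOf, Polynomial.eval_comp]
    refine TM2Iter.eval_mono cS ?_
    simp only [Polynomial.eval_add, Polynomial.eval_comp, Polynomial.eval_one, Polynomial.eval_X]
    omega
  -- bad coins for the oracle have a bad prefix for the counter
  have hsub : {u | decodeNat (bOracle qA cS F (perSqQuery M k u)) ∉ perSqWindow (2 * c + 1) M} ⊆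
      {u | u.take (ellOf qA cS M k) ∈ {u' | ¬ IsApproxCount 1
        (countWitnesses (samplerRel A) (mOf qA M) (bPre (qcode M)))
        (countEstimate F (bPre (qcode M)) (mOf qA M) 1 k u')}} := by
    intro u hu
    simp only [Set.mem_setOf_eq] at hu ⊢
    intro hgood
    apply hu
    rw [decodeNat_bOracle_perSqQuery]
    exact bosonRescale_mem_perSqWindow_tOf hc hmul hqA M hn hgood
  calc uniformProb ℓ {u | decodeNat (bOracle qA cS F (perSqQuery M k u)) ∉ perSqWindow (2 * c + 1) M}
      ≤ uniformProb ℓ {u | u.take (ellOf qA cS M k) ∈ {u' | ¬ IsApproxCount 1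
          (countWitnesses (samplerRel A) (mOf qA M) (bPre (qcode M)))
          (countEstimate F (bPre (qcode M)) (mOf qA M) 1 k u')}} := uniformProb_mono_set hsub
    _ = uniformProb (ellOf qA cS M k) {u' | ¬ IsApproxCount 1
          (countWitnesses (samplerRel A) (mOf qA M) (bPre (qcode M)))
          (countEstimate F (bPre (qcode M)) (mOf qA M) 1 k u')} := uniformProb_take_of_le hℓ'ℓ _
    _ ≤ 1 / (k : ℝ) := hF (bPre (qcode M)) (mOf qA M) 1 k one_pos hk

/-! ### The corrected S20 -/

/-- **The corrected S20 from Stockmeyer's theorem and AA13 Thm. 4.3 (randomised-oracle form), on the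
re-based reduction** (AA13, proof of Thm. 1.1, p. 178). Let `A` be a uniform sampler within the factor
`c` of `bosonSamplingProblem` with coin polynomial `qA`. Its coin predicate `samplerRel A` is in
`P = P^∅` (`samplerRel_mem_P_holds`, `PRel_empty_holds`), so Stockmeyer counting (`hStock`, Thm. 4.1)
provides `L ∈ NP^∅ = NP` and a counter `F ∈ FP^L`; the oracle `bOracle qA cS F` `(2c+1)`-approximates
`Per²` (`perSqRandOracleSolves_bOracle`) and lies in `FP^L` (`bOracle_mem_FPRel`); by Thm. 4.3
(`hHard`) `P^{#P} ⊆ BPP^{𝒪} ⊆ BPP^{L} ⊆ BPP^{NP}` (`OracleAlg.PRel_subset_PRel_of_mem_FPRel` through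
`BP·`). Compared with `PSharpP_subset_BPPRelClass_NP_of_uniformExactBosonSampling_of_facts'''`, the
hypotheses `PRel_subset_PRel_of_mem_FPRel` and `bosonReduction_mem_FP` are gone.
[cite: AaronsonArkhipovToC2013, Thm. 1.1, proof (p. 178)] -/
theorem PSharpP_subset_BPPRelClass_NP_of_uniformExactBosonSampling_of_hardness
    (hStock : stockmeyerApproxCounting) (hHard : PSharpP_subset_BPPRel_of_perSqRandOracleSolves) :
    PSharpP_subset_BPPRelClass_NP_of_uniformExactBosonSampling := by
  rintro ⟨A, hA, ⟨qA, hqA⟩, c, hc, hmul⟩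
  have hR : samplerRel A ∈ PRel Oracle.empty := by
    rw [PRel_empty_holds]
    exact samplerRel_mem_P_holds A hA
  obtain ⟨L, hL, F, hF, cS, hS⟩ := hStock Oracle.empty (samplerRel A) hR
  have hLNP : L ∈ NP := by rwa [NPRel_empty_of_PRel_empty PRel_empty_holds] at hL
  have hO : bOracle qA cS F ∈ FPRel (Oracle.ofLanguage L) := bOracle_mem_FPRel hF qA cS
  have hsolves : PerSqRandOracleSolves (2 * c + 1) (bOracle qA cS F) :=
    perSqRandOracleSolves_bOracle hc hmul hqA hS
  calc PSharpP ⊆ BPPRel (bOracle qA cS F) := hHard (2 * c + 1) _ (by linarith) hsolves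
    _ ⊆ BPPRel (Oracle.ofLanguage L) :=
        BPPRel_subset_BPPRel_of_mem_FPRel (fun _ _ hf => OracleAlg.PRel_subset_PRel_of_mem_FPRel hf) hO
    _ ⊆ BPPRelClass NP := BPPRel_subset_BPPRelClass hLNP

/-- **The corrected S20 from Valiant's theorem and the running-time fact of the search only**:
exact uniform `BosonSampling` by a classical sampler gives `P^{#P} ⊆ BPP^{NP}`
(`PSharpP_subset_BPPRelClass_NP_of_uniformExactBosonSampling`, the corrected form of the mis-stated
`PSharpP_subset_BPPRelClass_NP_of_exactBosonSampling` of `Sampling.lean`), assuming exactly Valiant's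
theorem (AA13 Thm. 4.2, `permanent01_isSharpPHardFun`) and `PerSearch.randSearchAlg_isPolyTime` (the
Thm-4.3 search runs in polynomial time); Stockmeyer's Thm. 4.1 is `stockmeyerApproxCounting_holds`,
Thm. 4.3 is `PSharpP_subset_BPPRel_of_perSqRandOracleSolves_of_facts`, and the reduction maps are the
proved machine of `BosonReductionMachine.lean`. [cite: AaronsonArkhipovToC2013, Thm. 1.1 and Cor. 4.5 (p. 178)] -/
theorem PSharpP_subset_BPPRelClass_NP_of_uniformExactBosonSampling_of_valiant
    (hVal : permanent01_isSharpPHardFun) (hPT : PerSearch.randSearchAlg_isPolyTime) :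
    PSharpP_subset_BPPRelClass_NP_of_uniformExactBosonSampling :=
  PSharpP_subset_BPPRelClass_NP_of_uniformExactBosonSampling_of_hardness
    StockMachine.stockmeyerApproxCounting_holds (PSharpP_subset_BPPRel_of_perSqRandOracleSolves_of_facts hVal hPT)

/-- **The original S20 shape for uniform samplers, under the same two facts**: an exact classical
`BosonSampling` sampler *with an exactly polynomial coin budget* gives `P^{#P} ⊆ BPP^{NP}`. (S20 itself
quantifies over samplers with an arbitrary polynomially *bounded* coin-length function and is not
implied; see `ExactBosonSamplingHardness.lean`, "Why S20 is mis-stated".) [cite: AaronsonArkhipovToC2013, Thm. 1.1 and Cor. 4.5 (p. 178)] -/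
theorem PSharpP_subset_BPPRelClass_NP_of_uniform_sampler_of_valiant
    (hVal : permanent01_isSharpPHardFun) (hPT : PerSearch.randSearchAlg_isPolyTime)
    (h : UniformExactBosonSampling) : PSharpP ⊆ BPPRelClass NP :=
  PSharpP_subset_BPPRelClass_NP_of_uniformExactBosonSampling_of_valiant hVal hPT h

end Literature.Computability.QuantumComplexity
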